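import Mathlib
import Literature.Barriers.MatrixMultiplication.NormalizerBarrier
import Summits.MatrixMultiplication.MatrixMultiplication.Theorems.SubgroupIdentityDesigns.Negative.GradedNormalizerCount

/-!
# Envelope counts: every probe count holds against `dim J|_E` for any envelope `E` of the tested
points (negative lemma for the crux `SubgroupIdentityDesigns`, stmt-MatrixMultiplication-14079)

All counting obstructions of this chain (walls, graded Neumann, permutability / stabiliser /
triangular counts: `GradedNormalizerCount.lean`, `StabilizerCount.lean`, `TriangularCount.lean`) bound a
number of PROBES — two-sided translates of the identity test `f ∈ J` — by `dim J`, using only that the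
probes take a unitriangular pattern of values at certain points.  Hence the same numbers are bounded by
the dimension of the RESTRICTION `J|_E = {F|_E : F ∈ J}` for any set `E` containing those points, e.g.
`E = ⟨H₁, H₂, H₃⟩` or any subgroup / subset containing the product set `H₁H₂H₃`:

* `card_le_finrank_restrict_of_triangular` — the master (certified-rank) form against `dim J|_E`
  (`J|_E = J.map (LinearMap.funLeft ℂ ℂ Subtype.val)`);
* `card_mul_card_le_finrank_restrict_outer` — the outer wall `|H₁| |H₃| ≤ dim J|_E` for `E ⊇ H₁H₃`.

In the crux (`J = F_k`), `dim F_k|_S` for a subgroup `S ≤ GL_m(𝔽_p)` is `Σ d_σ²` over the irreducible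
`σ` of `S` having a vector fixed by some `S ∩ Fix(W)` (`W` a `k`-subspace); for `S ⊇ SL_m(𝔽_p)` and
`k < m` this EXCLUDES the cuspidal part of `ℂ[S]` (no invariants under unipotent radicals), which is the
mechanism behind the census finding of the disprover seat that the "three distinct Borels" triples
`(U⁻μ, U''μ'', U⁺μ')` of `GL_2(𝔽_p)` — whose product set nearly fills `SL_2(𝔽_p)` — fail the level-1
test at `p = 3, 5, 7` although they pass every count against `dim F_1` (Cruxes/…/Disproof.lean v4).
Sorry-free; standard axioms.
-/

set_option linter.dupNamespace false

noncomputable section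

open scoped BigOperators Classical
open Literature.Barriers.MatrixMultiplication

namespace Summit.MatrixMultiplication.MatrixMultiplication.Theorems.SubgroupIdentityDesigns.Negative

variable {G : Type} [Fintype G]

/-- `dim J|_E ≤ dim J` — the restriction `J|_E` is the image of `J` under the linear map
`LinearMap.funLeft ℂ ℂ (Subtype.val : E → G)` (`F ↦ F|_E`). -/
theorem finrank_map_restrict_le (J : Submodule ℂ (G → ℂ)) (E : Set G) :
    Module.finrank ℂ (J.map (LinearMap.funLeft ℂ ℂ (Subtype.val : E → G))) ≤ Module.finrank ℂ J :=
  Submodule.finrank_map_le _ _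

variable [Group G]

/-- **ENVELOPE TRIANGULAR COUNT.**  If `s : Fin n → G` is injective with certificates `(u, v)` —
`uᵢ sᵢ vᵢ = 1` and `uᵢ sⱼ vᵢ ∈ S` for `j < i` — for an identity test `f ∈ J` on the set `S` (`f 1 = 1`,
`f = 0` on `S ∖ 1`), then `n ≤ dim J|_E` for EVERY set `E` containing the points `sᵢ`. -/
theorem card_le_finrank_restrict_of_triangular (J : Submodule ℂ (G → ℂ))
    (hJ : ∀ f ∈ J, ∀ a b : G, (fun g : G => f (a * g * b)) ∈ J)
    (S : Set G) {f : G → ℂ} (hf : f ∈ J) (h1 : f 1 = 1) (h0 : ∀ s ∈ S, s ≠ 1 → f s = 0)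
    {n : ℕ} (s u v : Fin n → G) (hinj : Function.Injective s)
    (hdiag : ∀ i, u i * s i * v i = 1) (hlow : ∀ i j, j < i → u i * s j * v i ∈ S)
    (E : Set G) (hE : ∀ i, s i ∈ E) :
    n ≤ Module.finrank ℂ (J.map (LinearMap.funLeft ℂ ℂ (Subtype.val : E → G))) := by
  classical
  -- the restricted probes
  let w : Fin n → J.map (LinearMap.funLeft ℂ ℂ (Subtype.val : E → G)) := fun i =>
    ⟨LinearMap.funLeft ℂ ℂ (Subtype.val : E → G) (fun g => f (u i * g * v i)), Submodule.mem_map_of_mem (hJ f hf _ _)⟩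
  have hM1 : ∀ i, (w i : E → ℂ) ⟨s i, hE i⟩ = 1 := fun i => by
    show f (u i * s i * v i) = 1
    rw [hdiag, h1]
  have hM0 : ∀ i j, j < i → (w i : E → ℂ) ⟨s j, hE j⟩ = 0 := by
    intro i j hji
    show f (u i * s j * v i) = 0
    refine h0 _ (hlow i j hji) fun h => (ne_of_gt hji) (hinj ?_)
    have e : u i * s j * v i = u i * s i * v i := by rw [h, hdiag]
    have e' : s j = s i := by
      calc s j = (u i)⁻¹ * (u i * s j * v i) * (v i)⁻¹ := by group
        _ = (u i)⁻¹ * (u i * s i * v i) * (v i)⁻¹ := by rw [e]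
        _ = s i := by group
    exact e'.symm
  have hli : LinearIndependent ℂ w := by
    rw [Fintype.linearIndependent_iff]
    intro c hc
    have hev : ∀ j, ∑ i, c i * (w i : E → ℂ) ⟨s j, hE j⟩ = 0 := fun j => by
      have := congrArg (fun φ : J.map (LinearMap.funLeft ℂ ℂ (Subtype.val : E → G)) => (φ : E → ℂ) ⟨s j, hE j⟩) hc
      simpa [Submodule.coe_sum, Finset.sum_apply] using this
    suffices h : ∀ m : ℕ, ∀ j : Fin n, (j : ℕ) = m → c j = 0 from fun j => h j j rfl
    intro m
    induction m using Nat.strong_induction_on with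
    | _ m ih =>
      intro j hj
      have key : ∑ i, c i * (w i : E → ℂ) ⟨s j, hE j⟩ = c j := by
        rw [Finset.sum_eq_single j]
        · rw [hM1, mul_one]
        · intro i _ hij
          rcases lt_or_gt_of_ne hij with h | h
          · rw [ih i (by rw [← hj]; exact h) i rfl, zero_mul]
          · rw [hM0 i j h, mul_zero]
        · intro h; exact absurd (Finset.mem_univ j) h
      rw [← key]
      exact hev j
  simpa using hli.fintype_card_le_finrank

/-- **ENVELOPE OUTER WALL.**  For a subgroup TPP triple with an identity test `f ∈ J` and ANY set
`E ⊇ H₁H₃`: `|H₁| · |H₃| ≤ dim J|_E` (the probes `g ↦ f(a⁻¹ g c⁻¹)` restricted to `E` are biorthogonal to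
the evaluations at the points `a' c' ∈ E`).  With `E = ⟨H₁, H₃⟩ ≤ S` this charges the pair against
`dim F_k|_S = Σ_{σ ∈ Irr S visible at level k} d_σ²` instead of `dim F_k`. -/
theorem card_mul_card_le_finrank_restrict_outer (J : Submodule ℂ (G → ℂ))
    (hJ : ∀ f ∈ J, ∀ a b : G, (fun g : G => f (a * g * b)) ∈ J)
    {H₁ H₂ H₃ : Subgroup G} (htpp : SubgroupTPP H₁ H₂ H₃)
    {f : G → ℂ} (hf : f ∈ J) (h1 : f 1 = 1)
    (h0 : ∀ a ∈ H₁, ∀ b ∈ H₂, ∀ c ∈ H₃, a * b * c ≠ 1 → f (a * b * c) = 0)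
    (E : Set G) (hE : ∀ a ∈ H₁, ∀ c ∈ H₃, a * c ∈ E) :
    Nat.card H₁ * Nat.card H₃ ≤ Module.finrank ℂ (J.map (LinearMap.funLeft ℂ ℂ (Subtype.val : E → G))) := by
  classical
  let w : ↥H₁ × ↥H₃ → J.map (LinearMap.funLeft ℂ ℂ (Subtype.val : E → G)) := fun t =>
    ⟨LinearMap.funLeft ℂ ℂ (Subtype.val : E → G) (fun g => f ((t.1 : G)⁻¹ * g * (t.2 : G)⁻¹)),
      Submodule.mem_map_of_mem (hJ f hf _ _)⟩
  have hw : ∀ t r : ↥H₁ × ↥H₃,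
      (w t : E → ℂ) ⟨(r.1 : G) * (r.2 : G), hE _ r.1.2 _ r.2.2⟩ = if t = r then 1 else 0 := by
    rintro ⟨⟨a, ha⟩, ⟨c, hc⟩⟩ ⟨⟨a', ha'⟩, ⟨c', hc'⟩⟩
    show f (a⁻¹ * (a' * c') * c⁻¹) = _
    have key : a⁻¹ * (a' * c') * c⁻¹ = (a⁻¹ * a') * 1 * (c' * c⁻¹) := by group
    rw [key, idTest_apply_eq_ite htpp h1 h0 (H₁.mul_mem (H₁.inv_mem ha) ha') H₂.one_mem
      (H₃.mul_mem hc' (H₃.inv_mem hc))]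
    have hiff : (a⁻¹ * a' = 1 ∧ True ∧ c' * c⁻¹ = 1) ↔ (a = a' ∧ c = c') := by
      constructor
      · rintro ⟨e1, -, e3⟩
        exact ⟨inv_mul_eq_one.1 e1, (mul_inv_eq_one.1 e3).symm⟩
      · rintro ⟨rfl, rfl⟩
        exact ⟨inv_mul_cancel a, trivial, mul_inv_cancel c⟩
    simp only [hiff, Prod.mk.injEq, Subtype.mk.injEq]
  have hli : LinearIndependent ℂ w := by
    rw [Fintype.linearIndependent_iff]
    intro g hg r
    have := congrArg (fun φ : J.map (LinearMap.funLeft ℂ ℂ (Subtype.val : E → G)) =>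
      (φ : E → ℂ) ⟨(r.1 : G) * (r.2 : G), hE _ r.1.2 _ r.2.2⟩) hg
    simpa [Submodule.coe_sum, Finset.sum_apply, hw, Finset.sum_ite_eq', Finset.mem_univ] using this
  have hcard := hli.fintype_card_le_finrank
  rw [← Nat.card_eq_fintype_card, Nat.card_prod] at hcard
  exact hcard

end Summit.MatrixMultiplication.MatrixMultiplication.Theorems.SubgroupIdentityDesigns.Negative

end
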